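import Mathlib
import Summits.Ventures.PercRepro2.OneTypedEdge

/-!
# The roots and `a₃` behind an unmarked cut vertex, I: the kernel on the states (blind cell
PercRepro2, p3 g3, 2026-08-25; `proofs/P3-BRIDGE.md` §11.7)

When an unmarked vertex `c` is a cut vertex of the support separating the side `VH ∋ a₁, a₂, a₃`
from the side `VL ∋ o, b`, a copy of the support has the state `glued5 h go gb` with `h` the five
root-side bits `(a₁ ↔ a₂, a₁ ↔ c, a₂ ↔ c, a₁ ↔ a₃, a₂ ↔ a₃)` and `go, gb` the far-side bits
`c ↔ o`, `c ↔ b`: `q′ = ρ`, `L₃ = λ`, `H₃ = η`, `L_v = α₁ ∧ g_v`, `H_v = α₂ ∧ g_v`.  On these states the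
kernel is the FOUR-monomial expansion `KB = cS·g_o g_b(w) + c₁·g_o(y) g_b(w) + c₂·g_b(y) g_o(w) +
c₃·g_o(x) g_b(y)` with root-side coefficients that are polynomials in the per-copy quantities
`P = 1[a₁ ↮ a₂]`, `d = 1[PD]`, `s₃ = σ₃`, `e = 1[a₁ ↔ c] − 1[a₂ ↔ c]`, `a = 1[a₁ ↔ c] + 1[a₂ ↔ c]`
(`KB_glued5`, a ring identity once the state factors are split).  On VALID bit vectors (the five
transitivity implications of a set partition, `Valid5`) the symmetrised same-copy coefficient and the
symmetrised sum of all four coefficients are nonnegative (`symS_nonneg`, `symS_add_symC_nonneg`;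
`decide` over the `32³` triples) — all the root-side content of the theorem.  Own work; standard
axioms.
-/

namespace Summit.Ventures.PercRepro2

namespace CovForm

namespace RootBridge

open OneTyped

/-- The five root-side bits `(a₁ ↔ a₂, a₁ ↔ c, a₂ ↔ c, a₁ ↔ a₃, a₂ ↔ a₃)`. -/
abbrev H5 := Bool × Bool × Bool × Bool × Bool

namespace H5
/-- `a₁ ↔ a₂`. -/
def ρ (h : H5) : Bool := h.1
/-- `a₁ ↔ c`. -/
def α₁ (h : H5) : Bool := h.2.1
/-- `a₂ ↔ c`. -/
def α₂ (h : H5) : Bool := h.2.2.1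
/-- `a₁ ↔ a₃`. -/
def lam3 (h : H5) : Bool := h.2.2.2.1
/-- `a₂ ↔ a₃`. -/
def eta3 (h : H5) : Bool := h.2.2.2.2
end H5

/-- The state of a copy when the roots and `a₃` sit behind `c` and `o, b` on the other side. -/
def glued5 (h : H5) (go gb : Bool) : St :=
  (h.ρ, h.α₁ && go, h.α₂ && go, h.α₁ && gb, h.α₂ && gb, h.lam3, h.eta3)

/-- `1[a₁ ↮ a₂]`. -/
def P5 (h : H5) : ℤ := if h.ρ then 0 else 1
/-- `1[PD] = 1[a₁ ↮ a₂, a₃ ∉ U]`. -/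
def d5 (h : H5) : ℤ := if h.ρ then 0 else if h.lam3 || h.eta3 then 0 else 1
/-- `σ₃`. -/
def s5 (h : H5) : ℤ := (if h.lam3 then 1 else 0) - (if h.eta3 then 1 else 0)
/-- `e = 1[a₁ ↔ c] − 1[a₂ ↔ c]`. -/
def e5 (h : H5) : ℤ := (if h.α₁ then 1 else 0) - (if h.α₂ then 1 else 0)
/-- `a = 1[a₁ ↔ c] + 1[a₂ ↔ c]`. -/
def a5 (h : H5) : ℤ := (if h.α₁ then 1 else 0) + (if h.α₂ then 1 else 0)
/-- A far-side bit as an integer. -/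
def ind (g : Bool) : ℤ := if g then 1 else 0

/-- The coefficient of the same-copy monomial `g_o g_b(w)` (terms 1, 3, 7 of `KB`). -/
def cS (x y w : H5) : ℤ :=
  d5 x * (P5 y * (P5 w * (e5 w * e5 w))) - d5 x * (P5 y * (P5 w * (s5 w * (a5 w * e5 w)))) -
    d5 x * (P5 y * (d5 w * (a5 w * a5 w)))

/-- The coefficient of `g_o(y) g_b(w)` (term 2). -/
def c1 (x y w : H5) : ℤ := P5 x * ((d5 y * a5 y) * (P5 w * (s5 w * e5 w)))

/-- The coefficient of `g_b(y) g_o(w)` (terms 4, 6, 8). -/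
def c2 (x y w : H5) : ℤ :=
  -(d5 x * ((P5 y * e5 y) * (P5 w * e5 w))) + d5 x * ((P5 y * e5 y) * (P5 w * (s5 w * a5 w))) +
    P5 x * ((d5 y * a5 y) * (d5 w * a5 w))

/-- The coefficient of `g_o(x) g_b(y)` (term 5). -/
def c3 (x y w : H5) : ℤ := -((d5 x * a5 x) * ((P5 y * e5 y) * (P5 w * s5 w)))

/-- `1_Q` of a glued state. -/
lemma qB_glued5 (h : H5) (go gb : Bool) : qB (glued5 h go gb) = P5 h := by
  rcases h with ⟨r, a1, a2, l, e⟩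
  cases r <;> simp [qB, glued5, P5, St.q', H5.ρ]

/-- `1_PD` of a glued state. -/
lemma pdB_glued5 (h : H5) (go gb : Bool) : pdB (glued5 h go gb) = d5 h := by
  rcases h with ⟨r, a1, a2, l, e⟩
  cases r <;> cases l <;> cases e <;> simp [pdB, glued5, d5, St.q', St.L3, St.H3, H5.ρ, H5.lam3, H5.eta3]

/-- `σ_o` of a glued state. -/
lemma sigB_o_glued5 (h : H5) (go gb : Bool) :
    sigB (glued5 h go gb).Lo (glued5 h go gb).Ho = e5 h * ind go := by
  rcases h with ⟨r, a1, a2, l, e⟩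
  cases a1 <;> cases a2 <;> cases go <;> simp [sigB, glued5, e5, ind, St.Lo, St.Ho, H5.α₁, H5.α₂]

/-- `σ_b` of a glued state. -/
lemma sigB_b_glued5 (h : H5) (go gb : Bool) :
    sigB (glued5 h go gb).Lb (glued5 h go gb).Hb = e5 h * ind gb := by
  rcases h with ⟨r, a1, a2, l, e⟩
  cases a1 <;> cases a2 <;> cases gb <;> simp [sigB, glued5, e5, ind, St.Lb, St.Hb, H5.α₁, H5.α₂]

/-- `σ₃` of a glued state. -/
lemma sigB_3_glued5 (h : H5) (go gb : Bool) :
    sigB (glued5 h go gb).L3 (glued5 h go gb).H3 = s5 h := by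
  rcases h with ⟨r, a1, a2, l, e⟩
  cases l <;> cases e <;> simp [sigB, glued5, s5, St.L3, St.H3, H5.lam3, H5.eta3]

/-- `1_{o ∈ U}` of a glued state. -/
lemma uB_o_glued5 (h : H5) (go gb : Bool) :
    uB (glued5 h go gb).Lo (glued5 h go gb).Ho = a5 h * ind go := by
  rcases h with ⟨r, a1, a2, l, e⟩
  cases a1 <;> cases a2 <;> cases go <;> simp [uB, glued5, a5, ind, St.Lo, St.Ho, H5.α₁, H5.α₂]

/-- `1_{b ∈ U}` of a glued state. -/
lemma uB_b_glued5 (h : H5) (go gb : Bool) :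
    uB (glued5 h go gb).Lb (glued5 h go gb).Hb = a5 h * ind gb := by
  rcases h with ⟨r, a1, a2, l, e⟩
  cases a1 <;> cases a2 <;> cases gb <;> simp [uB, glued5, a5, ind, St.Lb, St.Hb, H5.α₁, H5.α₂]

/-- **The kernel on glued states is the four-monomial expansion** (a ring identity in the per-copy
quantities). -/
theorem KB_glued5 (hx : H5) (gox gbx : Bool) (hy : H5) (goy gby : Bool) (hw : H5) (gow gbw : Bool) :
    KB (glued5 hx gox gbx) (glued5 hy goy gby) (glued5 hw gow gbw) =
      cS hx hy hw * (ind gow * ind gbw) + c1 hx hy hw * (ind goy * ind gbw) +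
        c2 hx hy hw * (ind gby * ind gow) + c3 hx hy hw * (ind gox * ind gby) := by
  unfold KB
  simp only [qB_glued5, pdB_glued5, sigB_o_glued5, sigB_b_glued5, sigB_3_glued5, uB_o_glued5,
    uB_b_glued5]
  unfold cS c1 c2 c3
  ring

/-- **Validity** of a root-side bit vector: the transitivity implications of a set partition on
the triangles `{a₁, a₂, c}` and `{a₁, a₂, a₃}`. -/
def Valid5 (h : H5) : Bool :=
  (!(h.α₁ && h.α₂) || h.ρ) && (!(h.α₁ && h.ρ) || h.α₂) && (!(h.α₂ && h.ρ) || h.α₁) &&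
    (!(h.lam3 && h.eta3) || h.ρ) && (!(h.lam3 && h.ρ) || h.eta3) && (!(h.eta3 && h.ρ) || h.lam3)

/-- The symmetrisation of a root-side coefficient over the copy order. -/
def sym5 (C : H5 → H5 → H5 → ℤ) (x y w : H5) : ℤ :=
  C x y w + C x w y + C y x w + C y w x + C w x y + C w y x

/-- **The symmetrised same-copy coefficient is nonnegative** on valid states. -/
theorem symS_nonneg (x y w : H5) (hx : Valid5 x = true) (hy : Valid5 y = true)
    (hw : Valid5 w = true) : 0 ≤ sym5 cS x y w := by
  revert x y w
  decide +kernel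

/-- **The symmetrised sum of all four coefficients is nonnegative** on valid states. -/
theorem symS_add_symC_nonneg (x y w : H5) (hx : Valid5 x = true) (hy : Valid5 y = true)
    (hw : Valid5 w = true) :
    0 ≤ sym5 cS x y w + (sym5 c1 x y w + sym5 c2 x y w + sym5 c3 x y w) := by
  revert x y w
  decide +kernel

end RootBridge

end CovForm

end Summit.Ventures.PercRepro2
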